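import Literature.Topology.Algebra.ProfiniteOutCongruence
import HarnessLib

/-!
# The congruence topology, IV: packaged maps into the profinite `Out`

Dixon–du Sautoy–Mann–Segal §5.2 Thm. 5.3 [cite: DixonEtAl1999, §5.2 Thm 5.3] (parts I–III:
`ProfiniteAutCongruence*.lean`, `ProfiniteOutCongruence.lean`).  Convenience layer for consumers of the
profinite `Out_top(G) = CongrOut G` (abc-iut L3 container `SemiAnbdVocab.ofReal`, residual (R2); [SemiAnbd]
Def. 5.1 (i)(c) "the resulting outer homomorphism `H → Out(π̂₁(𝔾_v))` … is continuous"), so that they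
need not touch the abstract quotient `TopOut`:

* `contMulAutOfContinuousMulEquiv : (G ≃ₜ* G) → contMulAut G` and the homomorphism
  `CongrOut.ofContinuousMulEquiv G : (G ≃ₜ* G) →* CongrOut G` ("the map `(P ≃ₜ* P) → Out(P)`"),
  `CongrOut.equivTopOut_mk`;
* continuity criteria: `CongrAut.continuous_iff` (levelwise, into discrete level groups) and
  `CongrOut.continuous_of_lift`.

Mathlib-level plumbing; nothing disputed is involved.
-/

namespace Literature.Topology.Algebra

open _root_.Topology
open Literature.AnabelianGeometry.EtaleTheta (contMulAut mem_contMulAut TopOut)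

universe u

section Maps

variable (G : Type u) [Group G] [TopologicalSpace G] [IsTopologicalGroup G]

variable {G} in
omit [IsTopologicalGroup G] in
/-- An isomorphism of topological groups `G ≃ₜ* G` as an element of `Aut_top(G) = contMulAut G`.
[cite: DixonEtAl1999, §5.2 Thm 5.3] -/
def contMulAutOfContinuousMulEquiv (α : G ≃ₜ* G) : contMulAut G :=
  ⟨α.toMulEquiv, (mem_contMulAut G).mpr ⟨α.continuous, α.symm.continuous⟩⟩

omit [IsTopologicalGroup G] in
/-- Underlying automorphism. [cite: DixonEtAl1999, §5.2 Thm 5.3] -/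
@[simp] theorem coe_contMulAutOfContinuousMulEquiv (α : G ≃ₜ* G) :
    ((contMulAutOfContinuousMulEquiv α : contMulAut G) : MulAut G) = α.toMulEquiv := rfl

omit [IsTopologicalGroup G] in
/-- `α ↦ [α]` turns `trans` into multiplication (composition on `MulAut G`):
`[α.trans β] = [β] * [α]`. [cite: DixonEtAl1999, §5.2 Thm 5.3] -/
theorem contMulAutOfContinuousMulEquiv_trans (α β : G ≃ₜ* G) :
    contMulAutOfContinuousMulEquiv (α.trans β) =
      contMulAutOfContinuousMulEquiv β * contMulAutOfContinuousMulEquiv α :=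
  Subtype.ext (MulEquiv.ext fun _ => rfl)

omit [IsTopologicalGroup G] in
/-- `[refl] = 1`. [cite: DixonEtAl1999, §5.2 Thm 5.3] -/
theorem contMulAutOfContinuousMulEquiv_refl :
    contMulAutOfContinuousMulEquiv (ContinuousMulEquiv.refl G) = 1 :=
  Subtype.ext (MulEquiv.ext fun _ => rfl)

/-- **The map `(G ≃ₜ* G) → Out_top(G)`** into the profinite `Out` of part III (`G ≃ₜ* G` carries no
group structure in Mathlib; `trans ↦ *` and `refl ↦ 1` are recorded below). [cite: DixonEtAl1999, §5.2 Thm 5.3] -/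
def CongrOut.ofContinuousMulEquiv (α : G ≃ₜ* G) : CongrOut G :=
  CongrOut.mk G ((CongrAut.equivContMulAut G).symm (contMulAutOfContinuousMulEquiv α))

/-- `[α.trans β] = [β] * [α]` in `Out_top(G)`. [cite: DixonEtAl1999, §5.2 Thm 5.3] -/
theorem CongrOut.ofContinuousMulEquiv_trans (α β : G ≃ₜ* G) :
    CongrOut.ofContinuousMulEquiv G (α.trans β) =
      CongrOut.ofContinuousMulEquiv G β * CongrOut.ofContinuousMulEquiv G α := by
  rw [CongrOut.ofContinuousMulEquiv, contMulAutOfContinuousMulEquiv_trans, map_mul, map_mul]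
  rfl

/-- `[refl] = 1` in `Out_top(G)`. [cite: DixonEtAl1999, §5.2 Thm 5.3] -/
theorem CongrOut.ofContinuousMulEquiv_refl :
    CongrOut.ofContinuousMulEquiv G (ContinuousMulEquiv.refl G) = 1 := by
  rw [CongrOut.ofContinuousMulEquiv, contMulAutOfContinuousMulEquiv_refl, map_one, map_one]

/-- The class in `CongrOut G` of an element of `contMulAut G`, compatible with `CongrOut.equivTopOut`:
`equivTopOut (CongrOut.mk (equiv.symm φ)) = TopOut.mk φ`. [cite: DixonEtAl1999, §5.2 Thm 5.3] -/
theorem CongrOut.equivTopOut_mk (φ : contMulAut G) :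
    CongrOut.equivTopOut (CongrOut.mk G ((CongrAut.equivContMulAut G).symm φ)) = TopOut.mk G φ := by
  rfl

/-- **Continuity criterion into the congruence topology**: a map into `Aut_top(G)` is continuous iff
all its levels `h ↦ (f h) mod charCore G n` (valued in the discrete `Aut(G ⧸ charCore G n)`) are
continuous, i.e. locally constant. [cite: DixonEtAl1999, §5.2 Thm 5.3] -/
theorem CongrAut.continuous_iff {H : Type*} [TopologicalSpace H] (f : H → CongrAut G) :
    Continuous f ↔ ∀ n : ℕ, Continuous fun h => CongrAut.levelMap G (f h) n :=
  (CongrAut.isInducing_levelMap G).continuous_iff.trans continuous_pi_iff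

/-- A map into `Out_top(G)` that lifts continuously to `Aut_top(G)` is continuous.
[cite: DixonEtAl1999, §5.2 Thm 5.3] -/
theorem CongrOut.continuous_of_lift {H : Type*} [TopologicalSpace H] {f : H → CongrOut G}
    (g : H → CongrAut G) (hg : Continuous g) (hfg : ∀ h, f h = CongrOut.mk G (g h)) : Continuous f := by
  have : f = CongrOut.mk G ∘ g := funext hfg
  rw [this]
  exact CongrOut.continuous_mk.comp hg

/-! ## The congruence subgroups `Γ(N)` (DdSMS §5.2) -/

/-- DdSMS's **congruence subgroup** `Γ(N) = {γ ∈ Aut(G) | [G, γ] ⊆ N}` = the automorphisms acting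
trivially on `G ⧸ N`, for a normal subgroup `N`. [cite: DixonEtAl1999, §5.2 Thm 5.3] -/
def CongrAut.congrSubgroup (N : Subgroup G) [N.Normal] : Subgroup (CongrAut G) where
  carrier := {γ | ∀ g : G,
    (((CongrAut.equivContMulAut G γ : contMulAut G) : MulAut G) g : G ⧸ N) = (g : G ⧸ N)}
  one_mem' := fun _ => rfl
  mul_mem' := by
    intro γ δ hγ hδ g
    exact (hγ ((((CongrAut.equivContMulAut G δ : contMulAut G) : MulAut G)) g)).trans (hδ g)
  inv_mem' := by
    intro γ hγ g
    have h := hγ ((((CongrAut.equivContMulAut G γ : contMulAut G) : MulAut G))⁻¹ g)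
    rw [MulAut.apply_inv_self] at h
    exact h.symm

omit [IsTopologicalGroup G] in
/-- Membership in `Γ(N)`. [cite: DixonEtAl1999, §5.2 Thm 5.3] -/
theorem CongrAut.mem_congrSubgroup_iff {N : Subgroup G} [N.Normal] {γ : CongrAut G} :
    γ ∈ CongrAut.congrSubgroup G N ↔
      ∀ g : G, (((CongrAut.equivContMulAut G γ : contMulAut G) : MulAut G) g : G ⧸ N) = (g : G ⧸ N) :=
  Iff.rfl

omit [IsTopologicalGroup G] in
/-- `Γ` is monotone in `N`. [cite: DixonEtAl1999, §5.2 Thm 5.3] -/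
theorem CongrAut.congrSubgroup_mono {N N' : Subgroup G} [N.Normal] [N'.Normal] (h : N ≤ N') :
    CongrAut.congrSubgroup G N ≤ CongrAut.congrSubgroup G N' := by
  intro γ hγ g
  have hg := hγ g
  rw [QuotientGroup.eq] at hg ⊢
  exact h hg

/-- `Γ(charCore G n)` is the kernel of the `n`-th level map. [cite: DixonEtAl1999, §5.2 Thm 5.3] -/
theorem CongrAut.levelMap_eq_one_iff (n : ℕ) (γ : CongrAut G) :
    CongrAut.levelMap G γ n = 1 ↔ γ ∈ CongrAut.congrSubgroup G (charCore G n) := by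
  rw [CongrAut.mem_congrSubgroup_iff]
  constructor
  · intro h g
    have h1 := levelHom_mk G n (CongrAut.equivContMulAut G γ) g
    change LevelAut.equivMulAut n (CongrAut.levelMap G γ n) (g : G ⧸ charCore G n) = _ at h1
    rw [h] at h1
    exact h1.symm
  · intro h
    apply (LevelAut.equivMulAut (G := G) n).injective
    apply MulEquiv.ext
    intro q
    induction q using QuotientGroup.induction_on with
    | H g =>
      change LevelAut.equivMulAut n (levelHom G n (CongrAut.equivContMulAut G γ)) (g : G ⧸ charCore G n) = _
      rw [levelHom_mk, h g]
      rfl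

/-- `Γ(charCore G n)` is OPEN in the congruence topology (by definition of the topology).
[cite: DixonEtAl1999, §5.2 Thm 5.3] -/
theorem CongrAut.isOpen_congrSubgroup_charCore (n : ℕ) :
    IsOpen (CongrAut.congrSubgroup G (charCore G n) : Set (CongrAut G)) := by
  have h : (CongrAut.congrSubgroup G (charCore G n) : Set (CongrAut G)) =
      (fun γ => CongrAut.levelMap G γ n) ⁻¹' {1} := by
    ext γ
    simp only [SetLike.mem_coe, Set.mem_preimage, Set.mem_singleton_iff]
    exact (CongrAut.levelMap_eq_one_iff G n γ).symm
  rw [h]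
  exact (isOpen_discrete _).preimage ((continuous_apply n).comp (CongrAut.continuous_levelMap G))

/-- For `G` compact, `Γ(N)` is open for EVERY open normal subgroup `N` (it contains
`Γ(charCore G N.index)`): the `Γ(N)` are DdSMS's basis of neighbourhoods of `1`.
[cite: DixonEtAl1999, §5.2 Thm 5.3] -/
theorem CongrAut.isOpen_congrSubgroup [CompactSpace G] (N : Subgroup G) [N.Normal]
    (hN : IsOpen (N : Set G)) : IsOpen (CongrAut.congrSubgroup G N : Set (CongrAut G)) :=
  Subgroup.isOpen_mono (CongrAut.congrSubgroup_mono G (charCore_index_le hN))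
    (CongrAut.isOpen_congrSubgroup_charCore G N.index)

/-- A homomorphism into a discrete group with open kernel is continuous. [folklore] -/
private theorem continuous_of_isOpen_ker {H K : Type*} [Group H] [TopologicalSpace H] [ContinuousMul H]
    [Group K] [TopologicalSpace K] [DiscreteTopology K] (f : H →* K) (hf : IsOpen (f.ker : Set H)) :
    Continuous f := by
  refine (IsLocallyConstant.iff_exists_open _).mpr (fun h => ?_) |>.continuous
  refine ⟨(fun h' => h⁻¹ * h') ⁻¹' (f.ker : Set H), hf.preimage (by fun_prop), by simp, fun h' hh' => ?_⟩
  have hk : f (h⁻¹ * h') = 1 := hh'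
  rw [map_mul, map_inv, inv_mul_eq_one] at hk
  exact hk.symm

/-- **Continuity criterion for homomorphisms into `Aut_top(G)`**: a homomorphism `f : H → Aut_top(G)`
from a topological group is continuous as soon as every `f⁻¹(Γ(charCore G n))` is open — e.g. as soon
as `f⁻¹(Γ(N))` is open for every open normal `N` ([SemiAnbd] Def. 5.1 (i)(c)-style continuity of
actions). [cite: DixonEtAl1999, §5.2 Thm 5.3] -/
theorem CongrAut.continuous_of_isOpen_comap {H : Type*} [Group H] [TopologicalSpace H] [ContinuousMul H]
    (f : H →* CongrAut G)
    (hf : ∀ n : ℕ, IsOpen ((CongrAut.congrSubgroup G (charCore G n)).comap f : Set H)) :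
    Continuous f := by
  rw [CongrAut.continuous_iff]
  intro n
  let fn : H →* LevelAut G n := (Pi.evalMonoidHom (fun n => LevelAut G n) n).comp ((CongrAut.levelMap G).comp f)
  have hker : (fn.ker : Set H) = ((CongrAut.congrSubgroup G (charCore G n)).comap f : Set H) := by
    ext h
    simp only [SetLike.mem_coe, MonoidHom.mem_ker, Subgroup.mem_comap]
    exact CongrAut.levelMap_eq_one_iff G n (f h)
  have hc : Continuous fn := continuous_of_isOpen_ker fn (by rw [hker]; exact hf n)
  exact hc

/-- The image of `Γ(N)` in `Out_top(G)` is open for every open normal `N` (`G` compact).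
[cite: DixonEtAl1999, §5.2 Thm 5.3] -/
theorem CongrOut.isOpen_image_congrSubgroup [CompactSpace G] (N : Subgroup G) [N.Normal]
    (hN : IsOpen (N : Set G)) :
    IsOpen (CongrOut.mk G '' (CongrAut.congrSubgroup G N : Set (CongrAut G))) :=
  QuotientGroup.isOpenMap_coe _ (CongrAut.isOpen_congrSubgroup G N hN)

/-- **From continuity into the profinite `Out` to congruence-continuity at every open level**: if
`f : H → Out_top(G)` is continuous with `f 1 = 1`, then for every open normal `N ≤ G` some
neighbourhood of `1` in `H` consists of elements whose class has a representative `β ∈ Aut_top(G)`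
with `β(y) · y⁻¹ ∈ N` for all `y` — the hypothesis shape `hCC` of the tree's [SemiAnbd] Prop. 5.2 (i)
chain (`ArithOuterActionCongruenceFinite.lean`), here DERIVED from continuity for the congruence
topology. [cite: DixonEtAl1999, §5.2 Thm 5.3] -/
theorem CongrOut.exists_nhds_congruent_reps [CompactSpace G] {H : Type*} [TopologicalSpace H] [One H]
    {f : H → CongrOut G} (hf : Continuous f) (h1 : f 1 = 1) (N : Subgroup G) [N.Normal]
    (hN : IsOpen (N : Set G)) :
    ∃ U ∈ 𝓝 (1 : H), ∀ u ∈ U, ∃ β : contMulAut G,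
      CongrOut.mk G ((CongrAut.equivContMulAut G).symm β) = f u ∧
        ∀ y : G, (β : MulAut G) y * y⁻¹ ∈ N := by
  refine ⟨f ⁻¹' (CongrOut.mk G '' (CongrAut.congrSubgroup G N : Set (CongrAut G))),
    (CongrOut.isOpen_image_congrSubgroup G N hN).preimage hf |>.mem_nhds ?_, fun u hu => ?_⟩
  · rw [Set.mem_preimage, h1]
    exact ⟨1, (CongrAut.congrSubgroup G N).one_mem, map_one _⟩
  · obtain ⟨γ, hγ, hγu⟩ := hu
    refine ⟨CongrAut.equivContMulAut G γ, ?_, fun y => ?_⟩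
    · rw [MulEquiv.symm_apply_apply]; exact hγu
    · have hy := (CongrAut.mem_congrSubgroup_iff G).mp hγ y
      rw [QuotientGroup.eq] at hy
      have h2 := N.inv_mem hy
      rw [mul_inv_rev, inv_inv] at h2
      -- `h2 : y⁻¹ * β y ∈ N`; conjugate by `y`
      have h3 := ‹N.Normal›.conj_mem _ h2 y
      simpa [mul_assoc] using h3

end Maps

end Literature.Topology.Algebra
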